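import Summits.Ventures.Crystal3D.Theorems.StickyWulffConstantCoaxialWallLawTailResidueDefsM
import Summits.Ventures.Crystal3D.Theorems.StickyWulffConstantCoaxialWallLawOnSiteBridge
import HarnessLib

/-!
# The automaton's predicates depend on the class frame only through its SLOT DOZEN (crux `CoaxialWallLaw`, stmt-Ventures-19481)
# — brick (L4′) of MODULE-CAPTURE-PLAN-g10 §7: class transfer needs classes only as (dozen, direction) pairs

HONEST FRAMING. Venture `Summits/Ventures/Crystal3D` (cell `crystal3d-full`); helper `--supports` the crux `CoaxialWallLaw`
(stmt-Ventures-19481, `route-Ventures-StickyWulffConstant`), registered line 'CoaxialWallLawCertificates' (planner cf-p1).  Census-free;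
F-C1 not moved.  Two frames `G, G'` with the same slot dozen `G '' fccSlots = G' '' fccSlots` give the SAME readings: `IsMenuNormal`, `IsFull`,
`IsTwinReading`, `IsNarrow`, `IsMoving`, `IsEndMove` (the cross frame `G ≫ R_m` has dozen `R_m '' (G '' fccSlots)`), hence `IsEndPairFlat`
transfers along any admissible class with the same dozen and direction (`isEndPairFlat_of_dozen`).  This is what lets `ModuleCapture`'s
deep case (generalized class collapse) work with (dozen, direction) pairs instead of frames as maps (a frame and its negative, or two
frames differing by a slot-dozen symmetry, are the same reader).
-/

noncomputable section

namespace Summit.Ventures.Crystal3D.Theorems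

namespace TailResidue

open Summit.Ventures.Crystal3D Finset
open scoped InnerProductSpace

section Dozen

variable {X : Finset (EuclideanSpace ℝ (Fin 3))} {v : WordVersion}
  {G G' : EuclideanSpace ℝ (Fin 3) ≃ₗᵢ[ℝ] EuclideanSpace ℝ (Fin 3)}
  (hGG : (G : EuclideanSpace ℝ (Fin 3) → EuclideanSpace ℝ (Fin 3)) '' ↑fccSlots =
    (G' : EuclideanSpace ℝ (Fin 3) → EuclideanSpace ℝ (Fin 3)) '' ↑fccSlots)

include hGG

/-- Slot images of `G` are slot images of `G'`. -/
theorem exists_slot_of_dozen_eq {w : EuclideanSpace ℝ (Fin 3)} (hw : w ∈ fccSlots) : ∃ w' ∈ fccSlots, G' w' = G w := by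
  have : G w ∈ (G' : EuclideanSpace ℝ (Fin 3) → EuclideanSpace ℝ (Fin 3)) '' ↑fccSlots := by
    rw [← hGG]; exact Set.mem_image_of_mem _ (Finset.mem_coe.2 hw)
  obtain ⟨w', hw', h⟩ := this
  exact ⟨w', Finset.mem_coe.1 hw', h⟩

/-- A property of all slot images transfers between frames with the same dozen. -/
theorem forall_slot_iff (P : EuclideanSpace ℝ (Fin 3) → Prop) : (∀ w ∈ fccSlots, P (G w)) ↔ (∀ w ∈ fccSlots, P (G' w)) := by
  constructor
  · intro h w hw
    obtain ⟨w₀, hw₀, e⟩ := exists_slot_of_dozen_eq hGG.symm hw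
    rw [← e]; exact h w₀ hw₀
  · intro h w hw
    obtain ⟨w₀, hw₀, e⟩ := exists_slot_of_dozen_eq hGG hw
    rw [← e]; exact h w₀ hw₀

/-- Menu normals depend on the dozen only. -/
theorem isMenuNormal_congr_dozen {m : EuclideanSpace ℝ (Fin 3)} : IsMenuNormal G m ↔ IsMenuNormal G' m := by
  unfold IsMenuNormal
  rw [forall_slot_iff hGG (fun x => ⟪x, m⟫_ℝ = 0 ∨ ⟪x, m⟫_ℝ = Real.sqrt (2 / 3) ∨ ⟪x, m⟫_ℝ = -Real.sqrt (2 / 3))]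

/-- `IsFull` depends on the dozen only. -/
theorem isFull_congr_dozen {b : EuclideanSpace ℝ (Fin 3)} : IsFull X G b ↔ IsFull X G' b := by
  unfold IsFull
  exact forall_slot_iff hGG (fun x => b + x ∈ X)

/-- `IsTwinReading` depends on the dozen only. -/
theorem isTwinReading_congr_dozen {m b : EuclideanSpace ℝ (Fin 3)} : IsTwinReading X G m b ↔ IsTwinReading X G' m b := by
  unfold IsTwinReading
  rw [isMenuNormal_congr_dozen hGG,
    forall_slot_iff hGG (fun x => ⟪x, m⟫_ℝ ≤ 0 → b + x ∈ X),
    forall_slot_iff hGG (fun x => ⟪x, m⟫_ℝ < 0 → b + (x - (2 * ⟪x, m⟫_ℝ) • m) ∈ X),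
    forall_slot_iff hGG (fun x => 0 < ⟪x, m⟫_ℝ → b + x ∉ X)]

/-- `IsNarrow` depends on the dozen only. -/
theorem isNarrow_congr_dozen {d b : EuclideanSpace ℝ (Fin 3)} : IsNarrow X G d b ↔ IsNarrow X G' d b := by
  unfold IsNarrow
  constructor
  · rintro ⟨hbd, m, hm, hdm, htr⟩
    exact ⟨hbd, m, (isMenuNormal_congr_dozen hGG).1 hm, hdm, (forall_slot_iff hGG (fun x => 0 < ⟪x, m⟫_ℝ → b + x ∈ X)).1 htr⟩
  · rintro ⟨hbd, m, hm, hdm, htr⟩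
    exact ⟨hbd, m, (isMenuNormal_congr_dozen hGG).2 hm, hdm, (forall_slot_iff hGG (fun x => 0 < ⟪x, m⟫_ℝ → b + x ∈ X)).2 htr⟩

/-- `IsMoving` depends on the dozen only. -/
theorem isMoving_congr_dozen {d b : EuclideanSpace ℝ (Fin 3)} : IsMoving X v G d b ↔ IsMoving X v G' d b := by
  unfold IsMoving
  simp only [isFull_congr_dozen hGG, isTwinReading_congr_dozen hGG, isNarrow_congr_dozen hGG]

omit hGG in
/-- The cross frames of two frames with the same dozen have the same dozen. -/
theorem dozen_trans_eq (hGG : (G : EuclideanSpace ℝ (Fin 3) → EuclideanSpace ℝ (Fin 3)) '' ↑fccSlots =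
      (G' : EuclideanSpace ℝ (Fin 3) → EuclideanSpace ℝ (Fin 3)) '' ↑fccSlots)
    (R : EuclideanSpace ℝ (Fin 3) ≃ₗᵢ[ℝ] EuclideanSpace ℝ (Fin 3)) :
    ((G.trans R) : EuclideanSpace ℝ (Fin 3) → EuclideanSpace ℝ (Fin 3)) '' ↑fccSlots =
      ((G'.trans R) : EuclideanSpace ℝ (Fin 3) → EuclideanSpace ℝ (Fin 3)) '' ↑fccSlots := by
  have e1 : ((G.trans R) : EuclideanSpace ℝ (Fin 3) → EuclideanSpace ℝ (Fin 3)) = R ∘ G := by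
    funext x; rfl
  have e2 : ((G'.trans R) : EuclideanSpace ℝ (Fin 3) → EuclideanSpace ℝ (Fin 3)) = R ∘ G' := by
    funext x; rfl
  rw [e1, e2, Set.image_comp, Set.image_comp, hGG]

/-- **`IsEndMove` depends on the class frame only through its dozen.** -/
theorem isEndMove_congr_dozen {d q b : EuclideanSpace ℝ (Fin 3)} : IsEndMove X v G d q b ↔ IsEndMove X v G' d q b := by
  unfold IsEndMove
  have hx : ∀ m : EuclideanSpace ℝ (Fin 3), IsMoving X v (G.trans (ℝ ∙ m)ᗮ.reflection) (b - q) b ↔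
      IsMoving X v (G'.trans (ℝ ∙ m)ᗮ.reflection) (b - q) b :=
    fun m => isMoving_congr_dozen (dozen_trans_eq hGG _)
  simp only [isFull_congr_dozen hGG, isNarrow_congr_dozen hGG, isTwinReading_congr_dozen hGG, isMoving_congr_dozen hGG, hx]

end Dozen

/-- **Flat end pairs transfer along a class with the same dozen and direction**: if `(b, q)` is a flat end pair of `E` witnessed by the class
`(G, d)`, and `(G', d)` is an admissible class of the systems `(S₁', S₂')` with `G' '' fccSlots = G '' fccSlots`, then `(b, q)` is a flat end pair
of `E` for `(S₁', S₂')`. -/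
theorem isEndPairFlat_of_dozen {E : Finset (EuclideanSpace ℝ (Fin 3))} {v : WordVersion} {S₁' S₂' : PlateSystem}
    {G G' : EuclideanSpace ℝ (Fin 3) ≃ₗᵢ[ℝ] EuclideanSpace ℝ (Fin 3)} {d q b : EuclideanSpace ℝ (Fin 3)}
    (hq : q ∈ E) (hb : b ∈ E) (hqd : q - d ∈ E) (hmove : IsEndMove E v G d q b)
    (hGG : (G' : EuclideanSpace ℝ (Fin 3) → EuclideanSpace ℝ (Fin 3)) '' ↑fccSlots =
      (G : EuclideanSpace ℝ (Fin 3) → EuclideanSpace ℝ (Fin 3)) '' ↑fccSlots)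
    (hadm : S₁'.Adm G' d ∨ S₂'.Adm G' d) : IsEndPairFlat E v S₁' S₂' b q :=
  ⟨hq, hb, G', d, hadm, hqd, (isEndMove_congr_dozen hGG).2 hmove⟩

end TailResidue

end Summit.Ventures.Crystal3D.Theorems

end
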